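import Literature.Topology.FourManifolds.HullRegularSublevel
import Literature.Topology.FourManifolds.RegularSlabCobordism
import Literature.Topology.FourManifolds.CobordismCancelTopIndex
import Literature.Topology.FourManifolds.ProperMorseFunction
import HarnessLib

/-!
# The triads of an open manifold between consecutive hulls, and Morse functions on them
# without critical points of top index (Phillips 1967, Lemma 1.1)

Topic `Literature/Topology/FourManifolds`; the handle-theoretic content of Phillips' Lemma 1.1
(consumer: the named fact
`Literature.Topology.Immersions.Phillips1967_exists_isLocalDiffeomorph_of_isParallelizable`).
Everything here is **proved**; the file introduces definitions (the triads as cobordisms) but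
no named facts.

Phillips 1967, Lemma 1.1 (p. 176): *"An open `n`-dimensional manifold `M` has a non-negative,
proper Morse function with no critical points of index `n`."*  Proof, second half: *"Consider
now the compact manifold-with-boundary `Mᵢ₊₁' - Int Mᵢ'`. … `(Mᵢ₊₁' - Int Mᵢ'; ∂Mᵢ', ∂Mᵢ₊₁')`
is a smooth manifold triad. By [Milnor, h-cobordism, Theorem 2.5], there is a Morse function
`fᵢ` … The critical points of index `n` may be eliminated from each of the triads in turn by
applying Theorem 8.1 of [Milnor]. This theorem requires the hypothesis
`H₀(Mᵢ₊₁' - Int Mᵢ', ∂Mᵢ₊₁') = 0`, but this is satisfied by the construction of the `Mᵢ'`.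
Indeed, if some component of `Mᵢ₊₁' - Int Mᵢ'` were not connected to `∂Mᵢ₊₁'`, it would form
a compact component of `Int Mᵢ₊₁' - Int Mᵢ'`, and therefore of `M - Int Mᵢ'`; this is
impossible."*

Here `Mᵢ' = compactHull {f ≤ aᵢ}` for regular values `a₁ < a₂` of a smooth `f` with
`{f ≤ a₂}` compact, on a manifold without compact components
(`Literature.Topology.FourManifolds.IsRegularPair`). With the regular functions `F₁`, `F₂` of
`exists_regular_sublevel_eq_compactHull` (`HullRegularSublevel.lean`: `{Fⱼ ≤ 0} = Mⱼ'`,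
`interior Mⱼ' = {Fⱼ < 0}`), the triad `M₂' - Int M₁'` is the regular sublevel set
`{F₁ F₂ ≤ 0}` (`IsRegularPair.triadFn`, `isRegularLevel_triadFn` — the trick of
`RegularSlabCobordism.lean`), hence (`RegularLevelSplitting.lean`) a compact `C^∞` manifold with
boundary `IsRegularPair.Triad`, whose boundary `{F₁ = 0} ⊔ {F₂ = 0}` splits into two open and
closed pieces; a general construction (`cobordismOfClopen`: a compact manifold with boundary is a
cobordism between an open-closed piece of its boundary and the complementary piece) makes it the
cobordism `IsRegularPair.cobordism` from `∂M₁'`-side to `∂M₂'`-side.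

* `IsRegularPair.exists_mem_connectedComponentIn_top` — **`H₀(M₂' - Int M₁', ∂M₂') = 0`**:
  every component of the triad meets the top boundary (Phillips' argument above, made precise:
  a component `C` missing `∂M₂'` is open relative to `M - Int M₁'` — at points of `∂M₁'` by the
  preconnected half-ball traces of `HullRegularSublevel.lean` — and closed, hence a component of
  `M - Int M₁'` with compact closure containing a component of `M - M₁'`, against the hull
  property `not_isCompact_closure_connectedComponentIn_compl_compactHull`);
  `IsRegularPair.exists_joined_inr` — the same as joinability in the triad (manifolds with
  boundary are locally path connected).
* `IsRegularPair.exists_isMorseFunction_criticalSetOfIndex_top_eq_empty` — **the triad carries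
  a Morse function without critical points of index `dim M`**: Milnor's Thm. 2.5 on the reversed
  triad (the tree's `Cobordism.exists_isMorseFunction_of`), Thm. 8.1 Index 0 (the tree's
  discharged `Cobordism.Milnor1965_cancel_index_zero_holds`, hypothesis `H₀ = 0` from the
  previous item), and turning the triad about (`Cobordism.IsMorseFunction.symm`,
  `criticalSetOfIndex_one_sub`).

## References

* A. Phillips, *Submersions of open manifolds*, Topology **6** (1967), Lemma 1.1 and its
  proof (p. 176). [Phillips1967]
* J. Milnor, *Lectures on the h-cobordism theorem* (1965), Thm. 2.5, Lemma 2.9, Thm. 8.1.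
  [MilnorHCobordism1965]
-/

open scoped Manifold ContDiff Topology
open Set Function Filter

noncomputable section

universe u

namespace Literature.Topology.FourManifolds

/-! ### A compact manifold with boundary is a cobordism between complementary open-closed
pieces of its boundary -/

section ClopenBoundary

variable {n : ℕ} {S : Type u} [TopologicalSpace S] [T2Space S] [SecondCountableTopology S]
  [CompactSpace S] [ChartedSpace (EuclideanHalfSpace (n + 1)) S] [IsManifold (𝓡∂ (n + 1)) ∞ S]

/-- The complementary piece of an open-and-closed piece `P` of the boundary `∂S`, as an open
subset of `∂S`. [folklore] -/
def boundaryCompl (P : TopologicalSpace.Opens ((𝓡∂ (n + 1)).boundary S))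
    (hP : IsClosed (P : Set ((𝓡∂ (n + 1)).boundary S))) :
    TopologicalSpace.Opens ((𝓡∂ (n + 1)).boundary S) :=
  ⟨(P : Set ((𝓡∂ (n + 1)).boundary S))ᶜ, hP.isOpen_compl⟩

omit [T2Space S] [SecondCountableTopology S] [CompactSpace S] [IsManifold (𝓡∂ (n + 1)) ∞ S] in
/-- Membership in the complementary piece. [folklore] -/
@[simp] theorem mem_boundaryCompl_iff {P : TopologicalSpace.Opens ((𝓡∂ (n + 1)).boundary S)}
    {hP : IsClosed (P : Set ((𝓡∂ (n + 1)).boundary S))} {p : (𝓡∂ (n + 1)).boundary S} :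
    p ∈ boundaryCompl P hP ↔ p ∉ P :=
  Iff.rfl

/-- **A compact manifold with boundary `S` is a cobordism from any open-and-closed piece `P`
of `∂S` to the complementary piece** (Milnor 1965, Def. 1.1: a cobordism is a compact manifold
with boundary together with a splitting of its boundary into two open-and-closed parts). Both
ends are embedded by the inclusion of open pieces of the boundary
(`BoundaryManifold.isSmoothEmbedding_opens_val`, Lee 2013, Thm. 5.11).
[cite: MilnorHCobordism1965, Def. 1.1 (PDF p. 2)] -/
def cobordismOfClopen (P : TopologicalSpace.Opens ((𝓡∂ (n + 1)).boundary S))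
    (hP : IsClosed (P : Set ((𝓡∂ (n + 1)).boundary S))) :
    Cobordism n P (boundaryCompl P hP) where
  W := S
  inl p := (p.1 : S)
  inr p := (p.1 : S)
  isSmoothEmbedding_inl := BoundaryManifold.isSmoothEmbedding_opens_val P
  isSmoothEmbedding_inr := BoundaryManifold.isSmoothEmbedding_opens_val (boundaryCompl P hP)
  disjoint_range := by
    refine disjoint_left.2 ?_
    rintro z ⟨p, rfl⟩ ⟨q, hq⟩
    have hpq : q.1 = p.1 := Subtype.ext hq
    exact q.2 (hpq ▸ p.2)
  range_inl_union_range_inr := by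
    ext z
    simp only [mem_union, mem_range]
    constructor
    · rintro (⟨p, rfl⟩ | ⟨p, rfl⟩)
      · exact p.1.2
      · exact p.1.2
    · intro hz
      by_cases hzP : (⟨z, hz⟩ : (𝓡∂ (n + 1)).boundary S) ∈ P
      · exact Or.inl ⟨⟨⟨z, hz⟩, hzP⟩, rfl⟩
      · exact Or.inr ⟨⟨⟨z, hz⟩, hzP⟩, rfl⟩

/-- The total space (definitional). [folklore] -/
@[simp] theorem cobordismOfClopen_W (P : TopologicalSpace.Opens ((𝓡∂ (n + 1)).boundary S))
    (hP : IsClosed (P : Set ((𝓡∂ (n + 1)).boundary S))) : (cobordismOfClopen P hP).W = S := rfl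

/-- The incoming end (definitional). [folklore] -/
@[simp] theorem cobordismOfClopen_inl (P : TopologicalSpace.Opens ((𝓡∂ (n + 1)).boundary S))
    (hP : IsClosed (P : Set ((𝓡∂ (n + 1)).boundary S))) (p : P) :
    (cobordismOfClopen P hP).inl p = (p.1 : S) := rfl

/-- The outgoing end (definitional). [folklore] -/
@[simp] theorem cobordismOfClopen_inr (P : TopologicalSpace.Opens ((𝓡∂ (n + 1)).boundary S))
    (hP : IsClosed (P : Set ((𝓡∂ (n + 1)).boundary S))) (p : boundaryCompl P hP) :
    (cobordismOfClopen P hP).inr p = (p.1 : S) := rfl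

/-- An open-and-closed piece of the (compact) boundary is compact. [folklore] -/
instance instCompactSpaceOpensBoundaryOfIsClosed
    (P : TopologicalSpace.Opens ((𝓡∂ (n + 1)).boundary S))
    [h : Fact (IsClosed (P : Set ((𝓡∂ (n + 1)).boundary S)))] : CompactSpace P := by
  haveI : CompactSpace ((𝓡∂ (n + 1)).boundary S) := isCompact_iff_compactSpace.1
    ((𝓡∂ (n + 1)).isClosed_boundary (M := S) (n := ∞) (by simp)).isCompact
  exact isCompact_iff_compactSpace.1 h.out.isCompact

end ClopenBoundary

/-! ### Regular pairs of levels and the triad between the hulls -/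

section Triad

variable {k : ℕ} {M : Type u} [TopologicalSpace M] [T2Space M] [SecondCountableTopology M]
  [ChartedSpace (EuclideanSpace ℝ (Fin (k + 1))) M] [IsManifold (𝓡 (k + 1)) ∞ M]

variable (k) in
/-- **Two consecutive regular levels of the exhaustion** (the data of one triad of Phillips'
Lemma 1.1): `M` has no compact component, `f` is smooth, `a₁ < a₂`, `{f ≤ a₂}` is compact, and
neither level `{f = a₁}`, `{f = a₂}` contains a critical point of `f`.
[cite: Phillips1967, proof of Lemma 1.1 (p. 176)] -/
structure IsRegularPair (f : M → ℝ) (a₁ a₂ : ℝ) : Prop where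
  /-- `M` has no compact connected component ("`M` is open"). -/
  not_isCompact_connectedComponent : ∀ x : M, ¬ IsCompact (connectedComponent x)
  /-- `f` is smooth. -/
  contMDiff : ContMDiff (𝓡 (k + 1)) 𝓘(ℝ, ℝ) ∞ f
  /-- The levels are ordered. -/
  lt : a₁ < a₂
  /-- The larger sublevel set is compact. -/
  isCompact : IsCompact (f ⁻¹' Iic a₂)
  /-- The lower level is regular. -/
  regular₁ : ∀ x, f x = a₁ → ¬ IsMCriticalPt (𝓡 (k + 1)) f x
  /-- The upper level is regular. -/
  regular₂ : ∀ x, f x = a₂ → ¬ IsMCriticalPt (𝓡 (k + 1)) f x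

namespace IsRegularPair

variable {f : M → ℝ} {a₁ a₂ : ℝ} (h : IsRegularPair k f a₁ a₂)

omit [T2Space M] [SecondCountableTopology M] [IsManifold (𝓡 (k + 1)) ∞ M] in
/-- The smaller sublevel set is compact. [folklore] -/
theorem isCompact₁ (h : IsRegularPair k f a₁ a₂) : IsCompact (f ⁻¹' Iic a₁) :=
  h.isCompact.of_isClosed_subset (isClosed_Iic.preimage h.contMDiff.continuous)
    (fun _ hx => le_trans (mem_Iic.1 hx) h.lt.le)

/-- The lower hull `M₁' = compactHull {f ≤ a₁}`.
[cite: Phillips1967, proof of Lemma 1.1 (p. 176)] -/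
def hull₁ (_h : IsRegularPair k f a₁ a₂) : Set M := Literature.Topology.compactHull (f ⁻¹' Iic a₁)

/-- The upper hull `M₂' = compactHull {f ≤ a₂}`.
[cite: Phillips1967, proof of Lemma 1.1 (p. 176)] -/
def hull₂ (_h : IsRegularPair k f a₁ a₂) : Set M := Literature.Topology.compactHull (f ⁻¹' Iic a₂)

/-- A regular function for the lower hull (`HullRegularSublevel.lean`). [folklore] -/
def fn₁ : M → ℝ :=
  Classical.choose (exists_regular_sublevel_eq_compactHull h.not_isCompact_connectedComponent
    h.contMDiff h.isCompact₁ h.regular₁)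

/-- A regular function for the upper hull (`HullRegularSublevel.lean`). [folklore] -/
def fn₂ : M → ℝ :=
  Classical.choose (exists_regular_sublevel_eq_compactHull h.not_isCompact_connectedComponent
    h.contMDiff h.isCompact h.regular₂)

/-- The defining properties of `fn₁` (`exists_regular_sublevel_eq_compactHull`). [folklore] -/
theorem fn₁_spec : ContMDiff (𝓡 (k + 1)) 𝓘(ℝ, ℝ) ∞ h.fn₁ ∧ h.fn₁ ⁻¹' Iic 0 = h.hull₁ ∧
    (∀ x, h.fn₁ x = 0 → f x = a₁ ∧ ¬ IsMCriticalPt (𝓡 (k + 1)) h.fn₁ x) ∧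
    interior h.hull₁ = h.fn₁ ⁻¹' Iio 0 ∧ IsCompact h.hull₁ ∧ ∃ C : ℝ, ∀ y, f y ≤ h.fn₁ y + C :=
  Classical.choose_spec (exists_regular_sublevel_eq_compactHull
    h.not_isCompact_connectedComponent h.contMDiff h.isCompact₁ h.regular₁)

/-- The defining properties of `fn₂` (`exists_regular_sublevel_eq_compactHull`). [folklore] -/
theorem fn₂_spec : ContMDiff (𝓡 (k + 1)) 𝓘(ℝ, ℝ) ∞ h.fn₂ ∧ h.fn₂ ⁻¹' Iic 0 = h.hull₂ ∧
    (∀ x, h.fn₂ x = 0 → f x = a₂ ∧ ¬ IsMCriticalPt (𝓡 (k + 1)) h.fn₂ x) ∧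
    interior h.hull₂ = h.fn₂ ⁻¹' Iio 0 ∧ IsCompact h.hull₂ ∧ ∃ C : ℝ, ∀ y, f y ≤ h.fn₂ y + C :=
  Classical.choose_spec (exists_regular_sublevel_eq_compactHull
    h.not_isCompact_connectedComponent h.contMDiff h.isCompact h.regular₂)

/-- `F₁` is smooth. [folklore] -/
theorem contMDiff_fn₁ : ContMDiff (𝓡 (k + 1)) 𝓘(ℝ, ℝ) ∞ h.fn₁ := h.fn₁_spec.1
/-- `F₂` is smooth. [folklore] -/
theorem contMDiff_fn₂ : ContMDiff (𝓡 (k + 1)) 𝓘(ℝ, ℝ) ∞ h.fn₂ := h.fn₂_spec.1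

/-- `M₁' = {F₁ ≤ 0}`. [folklore] -/
theorem mem_hull₁_iff (x : M) : x ∈ h.hull₁ ↔ h.fn₁ x ≤ 0 := by
  rw [← h.fn₁_spec.2.1]; rfl
/-- `M₂' = {F₂ ≤ 0}`. [folklore] -/
theorem mem_hull₂_iff (x : M) : x ∈ h.hull₂ ↔ h.fn₂ x ≤ 0 := by
  rw [← h.fn₂_spec.2.1]; rfl
/-- `Int M₁' = {F₁ < 0}`. [folklore] -/
theorem mem_interior_hull₁_iff (x : M) : x ∈ interior h.hull₁ ↔ h.fn₁ x < 0 := by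
  rw [h.fn₁_spec.2.2.2.1]; rfl
/-- `Int M₂' = {F₂ < 0}`. [folklore] -/
theorem mem_interior_hull₂_iff (x : M) : x ∈ interior h.hull₂ ↔ h.fn₂ x < 0 := by
  rw [h.fn₂_spec.2.2.2.1]; rfl
/-- `M₂'` is compact. [folklore] -/
theorem isCompact_hull₂ : IsCompact h.hull₂ := h.fn₂_spec.2.2.2.2.1
/-- `f ≤ F₁ + const`: `F₁` is proper when `f` is. [folklore] -/
theorem exists_le_fn₁_add : ∃ C : ℝ, ∀ y, f y ≤ h.fn₁ y + C := h.fn₁_spec.2.2.2.2.2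
/-- `f ≤ F₂ + const`: `F₂` is proper when `f` is. [folklore] -/
theorem exists_le_fn₂_add : ∃ C : ℝ, ∀ y, f y ≤ h.fn₂ y + C := h.fn₂_spec.2.2.2.2.2
/-- `{F₁ = 0} ⊆ {f = a₁}`. [folklore] -/
theorem apply_eq_of_fn₁_eq_zero {x : M} (hx : h.fn₁ x = 0) : f x = a₁ := (h.fn₁_spec.2.2.1 x hx).1
/-- `{F₂ = 0} ⊆ {f = a₂}`. [folklore] -/
theorem apply_eq_of_fn₂_eq_zero {x : M} (hx : h.fn₂ x = 0) : f x = a₂ := (h.fn₂_spec.2.2.1 x hx).1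
/-- `F₁` is regular on `{F₁ = 0}`. [folklore] -/
theorem not_isMCriticalPt_fn₁ {x : M} (hx : h.fn₁ x = 0) : ¬ IsMCriticalPt (𝓡 (k + 1)) h.fn₁ x :=
  (h.fn₁_spec.2.2.1 x hx).2
/-- `F₂` is regular on `{F₂ = 0}`. [folklore] -/
theorem not_isMCriticalPt_fn₂ {x : M} (hx : h.fn₂ x = 0) : ¬ IsMCriticalPt (𝓡 (k + 1)) h.fn₂ x :=
  (h.fn₂_spec.2.2.1 x hx).2

omit [T2Space M] [SecondCountableTopology M] [IsManifold (𝓡 (k + 1)) ∞ M] in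
/-- **`M₁' ⊆ Int M₂'`** (Phillips: "`Mᵢ' ⊂ Int Mᵢ₊₁'`"): `{f ≤ a₁} ⊆ {f < a₂} ⊆ Int {f ≤ a₂}`
and hulls are strictly nested (`compactHull_subset_interior_compactHull`).
[cite: Phillips1967, proof of Lemma 1.1 (p. 176)] -/
theorem hull₁_subset_interior_hull₂ : h.hull₁ ⊆ interior h.hull₂ := by
  haveI : LocallyConnectedSpace M :=
    ChartedSpace.locallyConnectedSpace (EuclideanSpace ℝ (Fin (k + 1))) M
  refine Literature.Topology.compactHull_subset_interior_compactHull
    (isClosed_Iic.preimage h.contMDiff.continuous) fun x hx => ?_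
  have hlt : f x < a₂ := lt_of_le_of_lt (mem_Iic.1 hx) h.lt
  exact interior_maximal (fun y (hy : f y < a₂) => (show y ∈ f ⁻¹' Iic a₂ from hy.le))
    (isOpen_lt h.contMDiff.continuous continuous_const) hlt

/-- In `M₁'` the upper function is negative. [folklore] -/
theorem fn₂_neg_of_fn₁_nonpos {x : M} (hx : h.fn₁ x ≤ 0) : h.fn₂ x < 0 :=
  (h.mem_interior_hull₂_iff x).1 (h.hull₁_subset_interior_hull₂ ((h.mem_hull₁_iff x).2 hx))

/-- Outside `Int M₁'` and on the boundary of `M₂'`, the lower function is positive. [folklore] -/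
theorem fn₁_pos_of_fn₂_eq_zero {x : M} (hx : h.fn₂ x = 0) : 0 < h.fn₁ x := by
  by_contra hle
  exact (h.fn₂_neg_of_fn₁_nonpos (not_lt.1 hle)).ne hx

/-- **The triad function `F₁ · F₂`.** [folklore] -/
def triadFn : M → ℝ := fun x => h.fn₁ x * h.fn₂ x

/-- Unfolding `triadFn`. [folklore] -/
theorem triadFn_apply (x : M) : h.triadFn x = h.fn₁ x * h.fn₂ x := rfl

/-- The triad function is smooth. [folklore] -/
theorem contMDiff_triadFn : ContMDiff (𝓡 (k + 1)) 𝓘(ℝ, ℝ) ∞ h.triadFn :=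
  h.contMDiff_fn₁.mul h.contMDiff_fn₂

/-- **`{F₁ F₂ ≤ 0} = M₂' - Int M₁'`**: the triad is a sublevel set. [folklore] -/
theorem triadFn_nonpos_iff (x : M) : h.triadFn x ≤ 0 ↔ h.fn₂ x ≤ 0 ∧ 0 ≤ h.fn₁ x := by
  rw [triadFn_apply]
  constructor
  · intro hx
    have h1 : 0 ≤ h.fn₁ x := by
      by_contra hneg
      push Not at hneg
      have h2 : h.fn₂ x < 0 := h.fn₂_neg_of_fn₁_nonpos hneg.le
      nlinarith
    refine ⟨?_, h1⟩
    rcases h1.lt_or_eq with hpos | hzero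
    · by_contra h2
      push Not at h2
      nlinarith
    · exact (h.fn₂_neg_of_fn₁_nonpos hzero.symm.le).le
  · rintro ⟨h2, h1⟩
    exact mul_nonpos_of_nonneg_of_nonpos h1 h2

/-- Membership in the triad, in terms of the hulls. [folklore] -/
theorem triadFn_nonpos_iff' (x : M) : h.triadFn x ≤ 0 ↔ x ∈ h.hull₂ ∧ x ∉ interior h.hull₁ := by
  rw [h.triadFn_nonpos_iff, h.mem_hull₂_iff, h.mem_interior_hull₁_iff, not_lt]

/-- The zeros of the triad function: exactly one of `F₁`, `F₂` vanishes. [folklore] -/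
theorem triadFn_eq_zero_iff (x : M) : h.triadFn x = 0 ↔ h.fn₁ x = 0 ∨ h.fn₂ x = 0 := mul_eq_zero

/-- On `{F₁ = 0}` the upper function does not vanish. [folklore] -/
theorem fn₂_ne_zero_of_fn₁_eq_zero {x : M} (hx : h.fn₁ x = 0) : h.fn₂ x ≠ 0 :=
  (h.fn₂_neg_of_fn₁_nonpos hx.le).ne

/-- **`0` is a regular level of `F₁ · F₂`**: `d(F₁F₂) = F₁ dF₂ + F₂ dF₁`, and at a zero exactly
one factor vanishes while the other function is regular there. [folklore] -/
theorem isRegularLevel_triadFn : IsRegularLevel (𝓡 (k + 1)) h.triadFn 0 := by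
  refine isRegularLevel_of_not_isMCriticalPt h.contMDiff_triadFn fun x hx hcrit => ?_
  have hd₁ : HasMFDerivAt (𝓡 (k + 1)) 𝓘(ℝ, ℝ) h.fn₁ x (mfderiv (𝓡 (k + 1)) 𝓘(ℝ, ℝ) h.fn₁ x) :=
    (h.contMDiff_fn₁.mdifferentiableAt (by simp)).hasMFDerivAt
  have hd₂ : HasMFDerivAt (𝓡 (k + 1)) 𝓘(ℝ, ℝ) h.fn₂ x (mfderiv (𝓡 (k + 1)) 𝓘(ℝ, ℝ) h.fn₂ x) :=
    (h.contMDiff_fn₂.mdifferentiableAt (by simp)).hasMFDerivAt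
  have hprod := (hd₁.mul hd₂).mfderiv
  unfold IsMCriticalPt at hcrit
  have heq : h.triadFn = h.fn₁ * h.fn₂ := rfl
  rw [heq] at hcrit
  rw [hcrit] at hprod
  -- `0 = F₁ x • dF₂ + F₂ x • dF₁`
  rcases (h.triadFn_eq_zero_iff x).1 hx with h1 | h2
  · have h2 : h.fn₂ x ≠ 0 := h.fn₂_ne_zero_of_fn₁_eq_zero h1
    rw [h1, zero_smul, zero_add] at hprod
    have : mfderiv (𝓡 (k + 1)) 𝓘(ℝ, ℝ) h.fn₁ x = 0 := by
      have h3 : h.fn₂ x • mfderiv (𝓡 (k + 1)) 𝓘(ℝ, ℝ) h.fn₁ x =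
          (0 : TangentSpace (𝓡 (k + 1)) x →L[ℝ] ℝ) := hprod.symm
      rcases smul_eq_zero.1 h3 with hc | hv
      · exact absurd hc h2
      · exact hv
    exact h.not_isMCriticalPt_fn₁ h1 this
  · have h1 : h.fn₁ x ≠ 0 := (h.fn₁_pos_of_fn₂_eq_zero h2).ne'
    rw [h2, zero_smul, add_zero] at hprod
    have : mfderiv (𝓡 (k + 1)) 𝓘(ℝ, ℝ) h.fn₂ x = 0 := by
      have h3 : h.fn₁ x • mfderiv (𝓡 (k + 1)) 𝓘(ℝ, ℝ) h.fn₂ x =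
          (0 : TangentSpace (𝓡 (k + 1)) x →L[ℝ] ℝ) := hprod.symm
      rcases smul_eq_zero.1 h3 with hc | hv
      · exact absurd hc h1
      · exact hv
    exact h.not_isMCriticalPt_fn₂ h2 this

/-- **The triad `M₂' - Int M₁'` as a compact `C^∞` manifold with boundary** — the regular
sublevel set `{F₁ F₂ ≤ 0}` (`Literature.RegularSublevel`, Milnor 1963, Thm. 3.1).
[cite: Phillips1967, proof of Lemma 1.1 (p. 176)] -/
abbrev Triad : Type u := RegularSublevel h.isRegularLevel_triadFn

/-- The triad is compact (a closed subset of the compact `M₂'`). [folklore] -/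
instance instCompactSpaceTriad : CompactSpace h.Triad := by
  refine isCompact_iff_compactSpace.1 (h.isCompact_hull₂.of_isClosed_subset
    (isClosed_Iic.preimage h.contMDiff_triadFn.continuous) fun x hx => ?_)
  exact ((h.triadFn_nonpos_iff' x).1 (mem_Iic.1 hx)).1

/-- A boundary point of the triad has `F₁ = 0` or `F₂ = 0` (and not both). [folklore] -/
theorem fn₁_eq_zero_or (p : (𝓡∂ (k + 1)).boundary h.Triad) :
    h.fn₁ (RegularSublevel.incl _ p.1) = 0 ∨ h.fn₂ (RegularSublevel.incl _ p.1) = 0 :=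
  (h.triadFn_eq_zero_iff _).1 ((RegularSublevel.mem_boundary_iff _ p.1).1 p.2)

/-- **The bottom end `∂M₁'` of the triad**, as an open subset of its boundary: the boundary
points with `F₁ = 0`, i.e. with `F₂ ≠ 0`. [cite: Phillips1967, proof of Lemma 1.1 (p. 176)] -/
def botEnd : TopologicalSpace.Opens ((𝓡∂ (k + 1)).boundary h.Triad) :=
  ⟨{p | h.fn₂ (RegularSublevel.incl _ p.1) ≠ 0},
    isOpen_ne_fun (h.contMDiff_fn₂.continuous.comp
      ((RegularSublevel.continuous_incl _).comp continuous_subtype_val)) continuous_const⟩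

/-- A boundary point lies in the bottom end iff `F₁ = 0` there. [folklore] -/
theorem mem_botEnd_iff (p : (𝓡∂ (k + 1)).boundary h.Triad) :
    p ∈ h.botEnd ↔ h.fn₁ (RegularSublevel.incl _ p.1) = 0 := by
  show h.fn₂ _ ≠ 0 ↔ _
  constructor
  · intro hp
    exact (h.fn₁_eq_zero_or p).resolve_right hp
  · intro hp
    exact h.fn₂_ne_zero_of_fn₁_eq_zero hp

/-- The bottom end is closed in `∂W`. [folklore] -/
theorem isClosed_botEnd : IsClosed (h.botEnd : Set ((𝓡∂ (k + 1)).boundary h.Triad)) := by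
  have : (h.botEnd : Set ((𝓡∂ (k + 1)).boundary h.Triad)) =
      {p | h.fn₁ (RegularSublevel.incl _ p.1) = 0} := by
    ext p; exact h.mem_botEnd_iff p
  rw [this]
  exact isClosed_eq (h.contMDiff_fn₁.continuous.comp
    ((RegularSublevel.continuous_incl _).comp continuous_subtype_val)) continuous_const

/-- The bottom end is closed (as a `Fact`, for the compactness instance). [folklore] -/
instance : Fact (IsClosed (h.botEnd : Set ((𝓡∂ (k + 1)).boundary h.Triad))) := ⟨h.isClosed_botEnd⟩

/-- **The top end `∂M₂'` of the triad**: the complementary piece, the boundary points with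
`F₂ = 0`. [cite: Phillips1967, proof of Lemma 1.1 (p. 176)] -/
def topEnd : TopologicalSpace.Opens ((𝓡∂ (k + 1)).boundary h.Triad) :=
  boundaryCompl h.botEnd h.isClosed_botEnd

/-- A boundary point lies in the top end iff `F₂ = 0` there. [folklore] -/
theorem mem_topEnd_iff (p : (𝓡∂ (k + 1)).boundary h.Triad) :
    p ∈ h.topEnd ↔ h.fn₂ (RegularSublevel.incl _ p.1) = 0 := by
  show p ∉ h.botEnd ↔ _
  rw [h.mem_botEnd_iff]
  constructor
  · intro hp
    exact (h.fn₁_eq_zero_or p).resolve_left hp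
  · intro hp h1
    exact h.fn₂_ne_zero_of_fn₁_eq_zero h1 hp

/-- The top end is closed in `∂W`. [folklore] -/
theorem isClosed_topEnd : IsClosed (h.topEnd : Set ((𝓡∂ (k + 1)).boundary h.Triad)) := by
  have : (h.topEnd : Set ((𝓡∂ (k + 1)).boundary h.Triad)) = (h.botEnd : Set _)ᶜ := rfl
  rw [this, isClosed_compl_iff]
  exact h.botEnd.isOpen

/-- The top end is closed (as a `Fact`, for the compactness instance). [folklore] -/
instance : Fact (IsClosed (h.topEnd : Set ((𝓡∂ (k + 1)).boundary h.Triad))) := ⟨h.isClosed_topEnd⟩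

/-- **The triad `(M₂' - Int M₁'; ∂M₁', ∂M₂')` as a cobordism** (Phillips: "a smooth manifold
triad"; Milnor 1965, Def. 1.1). [cite: Phillips1967, proof of Lemma 1.1 (p. 176)] -/
def cobordism : Cobordism k h.botEnd h.topEnd :=
  cobordismOfClopen h.botEnd h.isClosed_botEnd

/-- The total space of the triad cobordism (definitional). [folklore] -/
@[simp] theorem cobordism_W : h.cobordism.W = h.Triad := rfl

/-- The incoming end of the triad cobordism (definitional). [folklore] -/
@[simp] theorem cobordism_inl (p : h.botEnd) : h.cobordism.inl p = (p.1 : h.Triad) := rfl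

/-- The outgoing end of the triad cobordism (definitional). [folklore] -/
@[simp] theorem cobordism_inr (p : h.topEnd) : h.cobordism.inr p = (p.1 : h.Triad) := rfl


/-! ### `H₀(M₂' - Int M₁', ∂M₂') = 0` -/

/-- **Every component of the triad meets the top boundary `{F₂ = 0}`** (Phillips: "if some
component of `Mᵢ₊₁' - Int Mᵢ'` were not connected to `∂Mᵢ₊₁'`, it would form a compact
component of `Int Mᵢ₊₁' - Int Mᵢ'`, and therefore of `M - Int Mᵢ'`; this is impossible"). In
detail: a component `C` of `W = {F₁F₂ ≤ 0}` on which `F₂ < 0` is open relative to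
`S' = {F₁ ≥ 0} = M ∖ Int M₁'` (inside `{F₁ > 0}` by local connectedness of `M`, at points of
`{F₁ = 0}` by the preconnected traces `U ∩ {F₁ ≥ 0}` of `HullRegularSublevel.lean`) and closed,
hence equal to the component of `S'` through any of its points; it contains a point `x ∉ M₁'`
(regular points of `{F₁ = 0}` are adherent to `{F₁ > 0}`), hence the whole component of `x` in
`M ∖ M₁'`, whose closure would then be compact — excluded by the hull property of `M₁'`.
[cite: Phillips1967, proof of Lemma 1.1 (p. 176)] -/
theorem exists_mem_connectedComponentIn_fn₂_eq_zero {z : M} (hz : h.triadFn z ≤ 0) :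
    ∃ y ∈ connectedComponentIn (h.triadFn ⁻¹' Iic 0) z, h.fn₂ y = 0 := by
  classical
  haveI : LocallyConnectedSpace M :=
    ChartedSpace.locallyConnectedSpace (EuclideanSpace ℝ (Fin (k + 1))) M
  set W : Set M := h.triadFn ⁻¹' Iic 0 with hW
  set S' : Set M := {x | 0 ≤ h.fn₁ x} with hS'
  set C : Set M := connectedComponentIn W z with hC
  by_contra hcon
  push Not at hcon
  have hWmem : ∀ x, x ∈ W ↔ h.fn₂ x ≤ 0 ∧ 0 ≤ h.fn₁ x := fun x => by
    rw [hW, mem_preimage, mem_Iic, h.triadFn_nonpos_iff]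
  have hCW : C ⊆ W := connectedComponentIn_subset _ _
  have hWS : W ⊆ S' := fun x hx => ((hWmem x).1 hx).2
  have hzW : z ∈ W := hz
  have hzC : z ∈ C := mem_connectedComponentIn hzW
  have hC2 : ∀ x ∈ C, h.fn₂ x < 0 := fun x hx =>
    lt_of_le_of_ne ((hWmem x).1 (hCW hx)).1 (hcon x hx)
  -- (a) `C` is open relative to `S'`
  have hrel : ∀ w ∈ C, ∃ U : Set M, IsOpen U ∧ w ∈ U ∧ U ∩ S' ⊆ C := by
    intro w hw
    have hw2 : h.fn₂ w < 0 := hC2 w hw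
    have hw1 : 0 ≤ h.fn₁ w := hWS (hCW hw)
    have hCeq : connectedComponentIn W w = C := (connectedComponentIn_eq hw).symm
    have hN2 : {x | h.fn₂ x < 0} ∈ 𝓝 w :=
      (isOpen_lt h.contMDiff_fn₂.continuous continuous_const).mem_nhds hw2
    rcases hw1.lt_or_eq with hpos | hzero
    · -- `F₁ w > 0`: a connected open neighbourhood inside `{F₂ < 0} ∩ {F₁ > 0} ⊆ W`
      have hV : {x | h.fn₂ x < 0} ∩ {x | 0 < h.fn₁ x} ∈ 𝓝 w :=
        inter_mem hN2 ((isOpen_lt continuous_const h.contMDiff_fn₁.continuous).mem_nhds hpos)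
      obtain ⟨U, hUV, hUo, hwU, hUc⟩ :=
        (locallyConnectedSpace_iff_subsets_isOpen_isConnected.1 inferInstance) w _ hV
      have hUW : U ⊆ W := fun x hx => (hWmem x).2 ⟨le_of_lt (hUV hx).1, le_of_lt (hUV hx).2⟩
      have hUC : U ⊆ C := by
        rw [← hCeq]
        exact hUc.isPreconnected.subset_connectedComponentIn hwU hUW
      exact ⟨U, hUo, hwU, fun x hx => hUC hx.1⟩
    · -- `F₁ w = 0`: a preconnected trace `U ∩ {F₁ ≥ 0}` inside `{F₂ < 0}`
      have hw0 : h.fn₁ w = 0 := hzero.symm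
      obtain ⟨U, hU, hUsub, hUpre⟩ := exists_mem_nhds_isPreconnected_inter_setOf_le
        h.contMDiff_fn₁ (h.not_isMCriticalPt_fn₁ hw0) hN2
      rw [hw0] at hUpre
      have hUS : U ∩ S' ⊆ W := fun x hx => (hWmem x).2 ⟨le_of_lt (hUsub hx.1), hx.2⟩
      have hsubC : U ∩ S' ⊆ C := by
        rw [← hCeq]
        exact hUpre.subset_connectedComponentIn ⟨mem_of_mem_nhds hU, hw1⟩ hUS
      obtain ⟨U', hU'U, hU'o, hwU'⟩ := mem_nhds_iff.1 hU
      exact ⟨U', hU'o, hwU', fun x hx => hsubC ⟨hU'U hx.1, hx.2⟩⟩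
  -- (b) `C` is closed
  have hWc : IsClosed W := isClosed_Iic.preimage h.contMDiff_triadFn.continuous
  have hCc : IsClosed C := Literature.Topology.isClosed_connectedComponentIn_of_closure_subset
    ((closure_mono hCW).trans hWc.closure_subset)
  -- (c) `C` is the component of `z` in `S'`
  choose U hUo hwU hUS using hrel
  set O : Set M := ⋃ w : C, U w.1 w.2 with hO
  have hOo : IsOpen O := isOpen_iUnion fun w => hUo w.1 w.2
  have hOS : O ∩ S' = C := by
    apply Subset.antisymm
    · rintro x ⟨hx, hxS⟩
      obtain ⟨w, hw⟩ := mem_iUnion.1 hx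
      exact hUS w.1 w.2 ⟨hw, hxS⟩
    · intro x hx
      exact ⟨mem_iUnion.2 ⟨⟨x, hx⟩, hwU x hx⟩, hWS (hCW hx)⟩
  have hCO : C ⊆ O := fun x hx => (hOS.symm ▸ hx : x ∈ O ∩ S').1
  have hCS : connectedComponentIn S' z = C := by
    refine Subset.antisymm (fun x hx => ?_) (connectedComponentIn_mono z hWS)
    by_contra hxC
    have hpre := (isPreconnected_connectedComponentIn (x := z) (F := S'))
    have hsub : connectedComponentIn S' z ⊆ O ∪ Cᶜ := fun y _ => by
      by_cases hyC : y ∈ C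
      · exact Or.inl (hCO hyC)
      · exact Or.inr hyC
    obtain ⟨p, hp, hpO, hpC⟩ := hpre O Cᶜ hOo hCc.isOpen_compl hsub
      ⟨z, mem_connectedComponentIn (hWS hzW), hCO hzC⟩ ⟨x, hx, hxC⟩
    have : p ∈ O ∩ S' := ⟨hpO, connectedComponentIn_subset _ _ hp⟩
    rw [hOS] at this
    exact hpC this
  -- (d) a point of `C` outside `M₁'`
  obtain ⟨x, hxC, hx1⟩ : ∃ x ∈ C, 0 < h.fn₁ x := by
    rcases (show 0 ≤ h.fn₁ z from hWS hzW).lt_or_eq with hpos | hzero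
    · exact ⟨z, hzC, hpos⟩
    · have hz0 : h.fn₁ z = 0 := hzero.symm
      have hcl := mem_closure_setOf_lt_of_not_isMCriticalPt h.contMDiff_fn₁
        (h.not_isMCriticalPt_fn₁ hz0)
      rw [hz0] at hcl
      obtain ⟨x, hxU, hx0⟩ :=
        mem_closure_iff_nhds.1 hcl (U z hzC) ((hUo z hzC).mem_nhds (hwU z hzC))
      exact ⟨x, hUS z hzC ⟨hxU, (le_of_lt hx0 : 0 ≤ h.fn₁ x)⟩, hx0⟩
  -- (e) the component of `x` in `M ∖ M₁'` lies in `C`, so has compact closure — contradiction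
  have hxH : x ∉ h.hull₁ := fun hx' => (not_le.2 hx1) ((h.mem_hull₁_iff x).1 hx')
  have hH1c : (h.hull₁)ᶜ ⊆ S' := fun y hy => by
    have : ¬ h.fn₁ y ≤ 0 := fun h' => hy ((h.mem_hull₁_iff y).2 h')
    exact le_of_lt (not_le.1 this)
  have hDC : connectedComponentIn (h.hull₁)ᶜ x ⊆ C := by
    have h1 : connectedComponentIn (h.hull₁)ᶜ x ⊆ connectedComponentIn S' x :=
      connectedComponentIn_mono x hH1c
    have hxS : x ∈ connectedComponentIn S' z := hCS.symm ▸ hxC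
    have h2 : connectedComponentIn S' x = connectedComponentIn S' z :=
      (connectedComponentIn_eq hxS).symm
    rw [h2, hCS] at h1
    exact h1
  have hWcpt : IsCompact W :=
    h.isCompact_hull₂.of_isClosed_subset hWc fun y hy => ((h.triadFn_nonpos_iff' y).1 hy).1
  have hcpt : IsCompact (closure (connectedComponentIn (h.hull₁)ᶜ x)) :=
    hWcpt.of_isClosed_subset isClosed_closure
      (((closure_mono hDC).trans hCc.closure_subset).trans hCW)
  exact Literature.Topology.not_isCompact_closure_connectedComponentIn_compl_compactHull hxH hcpt

/-- **`H₀(M₂' - Int M₁', ∂M₂') = 0` in the form used by Milnor's Thm. 8.1**: every point of the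
triad is joined, by a path in the triad, to a point of the top end — manifolds with boundary
are locally path connected, so components of the triad are path components.
[cite: Phillips1967, proof of Lemma 1.1 (p. 176)] -/
theorem exists_joined_inr (z : h.Triad) : ∃ y : h.topEnd, Joined z (h.cobordism.inr y) := by
  haveI : LocallyPathConnectedSpace h.Triad :=
    ChartedSpace.locallyPathConnectedSpace (EuclideanHalfSpace (k + 1)) h.Triad
  obtain ⟨y, hyC, hy0⟩ := h.exists_mem_connectedComponentIn_fn₂_eq_zero z.2
  rw [connectedComponentIn_eq_image z.2] at hyC
  change y ∈ (fun p : h.Triad => RegularSublevel.incl h.isRegularLevel_triadFn p) ''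
    connectedComponent z at hyC
  obtain ⟨y', hy'c, hy'y⟩ := hyC
  have hjoined : Joined z y' := by
    rw [← pathComponent_eq_connectedComponent] at hy'c
    exact mem_pathComponent_iff.1 hy'c
  have hval : RegularSublevel.incl h.isRegularLevel_triadFn y' = y := hy'y
  have hy'bd : (y' : h.Triad) ∈ (𝓡∂ (k + 1)).boundary h.Triad :=
    (RegularSublevel.mem_boundary_iff _ y').2
      (by rw [hval]; exact (h.triadFn_eq_zero_iff y).2 (Or.inr hy0))
  refine ⟨⟨⟨y', hy'bd⟩, (h.mem_topEnd_iff _).2 ?_⟩, hjoined⟩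
  show h.fn₂ (RegularSublevel.incl _ y') = 0
  rw [hval]
  exact hy0

/-! ### Morse functions on the triad without critical points of top index -/

/-- **Phillips 1967, Lemma 1.1, second clause, one triad at a time**: the triad
`(M₂' - Int M₁'; ∂M₁', ∂M₂')` between two consecutive hulls carries a Morse function (in the
sense of `Cobordism.IsMorseFunction`: `= 0` on `∂M₁'`, `= 1` on `∂M₂'`) **without critical
points of index `dim M = k + 1`**. Proof as printed: a Morse function on the triad exists
(Milnor 1965, Thm. 2.5, the tree's `Cobordism.exists_isMorseFunction_of`, applied to the
reversed triad), and since every point of the triad is joined to `∂M₂'`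
(`exists_joined_inr`, i.e. `H₀(M₂' - Int M₁', ∂M₂') = 0`), Milnor's Thm. 8.1 Index 0 (the
tree's `Cobordism.Milnor1965_cancel_index_zero_holds`) removes the critical points of index `0`
of the reversed triad, i.e. (turning about, `Cobordism.IsMorseFunction.symm`) those of index
`k + 1` of the triad. [cite: Phillips1967, Lemma 1.1 (p. 176)]
[cite: MilnorHCobordism1965, Thm. 2.5 and Thm. 8.1 Index 0 (PDF pp. 6, 54)] -/
theorem exists_isMorseFunction_criticalSetOfIndex_top_eq_empty :
    ∃ g : h.Triad → ℝ, h.cobordism.IsMorseFunction g ∧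
      criticalSetOfIndex (𝓡∂ (k + 1)) g (k + 1) = ∅ := by
  -- the tree's `CobordismCancelTopIndex.lean` packages exactly this composition
  -- (Thm. 2.5 on the reversed triad, Thm. 8.1 Index 0, turning about)
  exact h.cobordism.exists_isMorseFunction_criticalSetOfIndex_top_eq_empty fun z =>
    h.exists_joined_inr z

end IsRegularPair

/-! ### Phillips' Lemma 1.1 assembled: the exhaustion of an open manifold by triads without
handles of top index -/

omit [T2Space M] [SecondCountableTopology M] [IsManifold (𝓡 (k + 1)) ∞ M]
  [ChartedSpace (EuclideanSpace ℝ (Fin (k + 1))) M] in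
/-- Sublevel sets of a continuous function tending to `+∞` along the cocompact filter are
compact. [folklore] -/
theorem isCompact_preimage_Iic_of_tendsto_cocompact {g : M → ℝ} (hg : Continuous g)
    (hprop : Tendsto g (cocompact M) atTop) (a : ℝ) : IsCompact (g ⁻¹' Iic a) := by
  rw [(hasBasis_cocompact (X := M)).tendsto_iff atTop_basis] at hprop
  obtain ⟨K, hK, hKf⟩ := hprop (a + 1) trivial
  refine hK.of_isClosed_subset (isClosed_Iic.preimage hg) fun x hx => ?_
  by_contra hxK
  have h1 : a + 1 ≤ g x := hKf x hxK
  have h2 : g x ≤ a := hx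
  linarith

/-- **Phillips 1967, Lemma 1.1 (handle-theoretic form).** Let `M` be an open `C^∞` manifold
modelled on `ℝᵏ⁺¹` — Hausdorff, second countable, without compact components. Then there are a
non-negative proper Morse function `f` on `M` (`ProperMorseFunction.lean`) and regular levels
`c 0 < c 1 < ⋯ → ∞` such that, with `Mᵢ' = compactHull {f ≤ c i}` (compact, `Mᵢ' ⊆ Int Mᵢ₊₁'`,
`⋃ Mᵢ' = M`), every pair of consecutive levels is an `IsRegularPair`; consequently
(`IsRegularPair.exists_isMorseFunction_criticalSetOfIndex_top_eq_empty`) each triad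
`(Mᵢ₊₁' - Int Mᵢ'; ∂Mᵢ', ∂Mᵢ₊₁')` is a cobordism carrying a Morse function **without critical
points of index `k + 1 = dim M`** — Phillips: "An open `n`-dimensional manifold has a
non-negative, proper Morse function with no critical points of index `n`", in the form produced
by his proof (one Morse function per triad; the splicing of these into a single global function,
"the `fᵢ` can be fitted together", is not carried out here and is not needed for the handle
decomposition of `M` that the lemma feeds).
[cite: Phillips1967, Lemma 1.1 and its proof (p. 176)] -/
theorem exists_isRegularPair_exhaustion
    (hopen : ∀ x : M, ¬ IsCompact (connectedComponent x)) :
    ∃ (f : M → ℝ) (c : ℕ → ℝ), IsMorse (𝓡 (k + 1)) f ∧ (∀ x, 0 ≤ f x) ∧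
      Tendsto f (cocompact M) atTop ∧ StrictMono c ∧
      (∀ i, IsRegularPair k f (c i) (c (i + 1))) ∧
      (⋃ i, Literature.Topology.compactHull (f ⁻¹' Iic (c i))) = univ ∧
      (∀ i, Literature.Topology.compactHull (f ⁻¹' Iic (c i)) ⊆
        interior (Literature.Topology.compactHull (f ⁻¹' Iic (c (i + 1))))) ∧
      ∀ i (h : IsRegularPair k f (c i) (c (i + 1))), ∃ g : h.Triad → ℝ,
        h.cobordism.IsMorseFunction g ∧ criticalSetOfIndex (𝓡∂ (k + 1)) g (k + 1) = ∅ := by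
  obtain ⟨f, hf, hf0, hft⟩ := exists_isMorse_tendsto_cocompact_atTop_euclidean (k + 1) M
  obtain ⟨c, hcmono, hctop, hcreg⟩ := exists_strictMono_regularLevel_of_isMorse hf hft
  have hpair : ∀ i, IsRegularPair k f (c i) (c (i + 1)) := fun i =>
    { not_isCompact_connectedComponent := hopen
      contMDiff := hf.1
      lt := hcmono (Nat.lt_succ_self i)
      isCompact := isCompact_preimage_Iic_of_tendsto_cocompact hf.1.continuous hft _
      regular₁ := fun x hx => hcreg i x hx
      regular₂ := fun x hx => hcreg (i + 1) x hx }
  refine ⟨f, c, hf, hf0, hft, hcmono, hpair, ?_, fun i => (hpair i).hull₁_subset_interior_hull₂,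
    fun i h => h.exists_isMorseFunction_criticalSetOfIndex_top_eq_empty⟩
  refine eq_univ_of_forall fun x => ?_
  obtain ⟨i, hi⟩ := (hctop.eventually (eventually_ge_atTop (f x))).exists
  exact mem_iUnion.2 ⟨i, Literature.Topology.subset_compactHull _ (mem_Iic.2 hi)⟩

end Triad

end Literature.Topology.FourManifolds
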